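import Summits.QuantumFields.BalabanUV.T4Continuum.Spine.NE1p.DressedSmallFieldComponentSets

/-!
# T⁴ programme, spine estimate NE1′ (node O3b/H2) — N0w's CREW COMPLEMENT, PART 2: THE COMPONENTS' INNER COUNTS COMPOSED FROM N0u —
# N0w's displayed inner-count SHAPE `hinner : Σ_{l ∈ I Z₀} m Z₀ l ≤ e^{c₀}·e^{−R₀ d_k Z₀}` SUPPLIED BY NAME by N0u's `innerCount_le_decay` for
# N0u's own labels `⟨W, (𝐃, P)⟩` (`c₀ := Gk.c₁u_k − 5R_k`, `R₀ := R_k − Gk.c₁u_k`), and both N0w's END (one component per member) and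
# PART 1's END (nonempty sets of components) fired ONCE with it — the whole of (B3-count)'s four resummation steps in ONE kernel implication
# on the cell's format, with DISPLAYED of printed KIND only the LINKS, the (2.36) transfer, the anchor ∕ closure READING data and rate arithmetic

Cell `pub-balaban`, sub-cell `t4`, BINDER-OWNERS row NE1′ (owner lineage t4-ne1p-p1, road P1); crew seat
`b2b-balaban-t4-ne1p-formalise-leaf-01` (LEAF PROVER 01, generation 13); crew row S41 ∕ DAG N29zzm, PART 2 of 2 (INTENT `CLAIMS.log`
2026-08-20 l.19296, RE-SCOPED l.19534, BOOKED typer R-T125 (iii) l.19575).  ADDITIVE — imports PART 1 `Spine/NE1p/DressedSmallFieldComponentSets`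
ONLY (→ the owner's N0w `DressedSmallFieldComponentCount` → N0v → N0u `DressedSmallFieldInnerCount` → N0t → N0s → …; b13's `B13FamilySum` in
the cone); THEOREMS ONLY (0 `def`, 0 `def … : Prop`, 0 cite); nothing of N0s ∕ N0u ∕ N0v ∕ N0w ∕ PART 1 ∕ b13 is restated —
`innerCount_le_decay`, `c₁_pos_of_geometry`, `ineq229_locDomainSys`, N0w's `attachedPart_locE_le_of_coresAt_pencil_components` and PART 1's
`attachedPart_locE_le_of_coresAt_pencil_componentSets` are used BY NAME, ONCE each.

WHAT.
* §1 `innerSum_le_of_innerCount` (kernel): N0u's `innerCount_le_decay` ONCE at `C₀ := Gk.cubes Z₀` (volume bound `Gk.volBound Z₀`, (2.29)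
  at scale `k` by b13's `ineq229_locDomainSys` on `Gk` under print's order of choice `κ₀ + 1 ≤ δκ`, `e K₀ c₁ α₆ ≤ 1`, the bonds-per-cube
  clause `hb₀`, N0u's (2.27)∘(2.32)-KIND link `hlink` DISPLAYED) for `terms :=` N0u's admissible labels of `Z₀` WRITTEN OUT (`W ⊆ Gk.cubes Z₀`,
  `𝐃` covering `Gk.cubes Z₀ ∖ W` exactly, `P ⊆ bondsOf W`, `#W ≤ 2·#P`) ⇒ EXACTLY N0w's `hinner` SHAPE with `c₀ := Gk.c₁u_k − 5R_k`,
  `R₀ := R_k − Gk.c₁u_k`, `u_k := e^{R_k c₃₂}·s·e^{b₀t}`.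
* §2 `attachedPart_locE_le_of_coresAt_pencil_components_inner` (kernel): N0w's END ONCE BY NAME at the inner-label type
  `Σ _ : Finset CubeK, Finset Dk.Dom × Finset Bnd`, `I`∕`m`∕`c₀`∕`R₀` as above, `hinner` SUPPLIED by §1 — N0w's only SHAPE binder GONE;
  `0 ≤ R_k` DERIVED from `hκR : Gk.κ₀ ≤ R_k − Gk.c₁u_k`.  The amplitude in N0v's (2.29) clause reads `ε·e^{Gk.c₁u_k − 5R_k}·Aₐ·Gk.K₀·e^{5R}`:
  the member's `e^{−5R}` is PAID by the inner count's `e^{−5R_k}` — print p. 20 «The inequality (2.27) is used for the remaining exponential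
  factors», the cell's `+5` travelling from scale `k` to scale `k+1` ((B5)-KIND bookkeeping, nothing of print asserted).
* §2 `attachedPart_locE_le_of_coresAt_pencil_componentSets_inner` (kernel): PART 1's set-valued END ONCE BY NAME with the same plug-in.
WHAT STAYS DISPLAYED (binders, by name; NOTHING instantiated on Bałaban's densities): the room, operator conditions, class radii; (B1b)'s
residue `terms`∕`emb`∕`hscale`∕`hact` and `hadm` (inner data range over `(univ.filter (cl · = Z′)).sigma (N0u's admissible labels)` — one
element, resp. a nonempty subset; (B1b)∕(2.35) READING); N0u's `bondsOf`∕`hb₀` and (2.27)∘(2.32)-KIND link `hlinkk` per component; N0w's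
closure `cl`, anchor `anc`∕`hanchor`∕`hA` and (2.36)-KIND transfer `htransfer` (displayed over an ABSTRACT `Gk`; factor `ℓ` a binder, NO
numeral; on pv22's nested tori they are crew row S44's); N0v's
(2.27)∘(2.37)-KIND link `hlink` and `hRR` (crew leaf-07's `DressedSmallFieldInnerLink` ∕ `…OuterLink` discharge the two links at `5` on
unit-cube geometries BY NAME — composable, not imported); (B3-amp) `hAmp` (p. 18's clause KIND at `C₃(E₀ + D₀)`, NOT asserted); the
(2.29) clauses at BOTH scales; the rate bookkeeping `hκR`∕`hrate2` — (B5)-KIND arithmetic whose standing against print's δ, κ, κ₁, α₆, L, M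
is NOT asserted.  NO torus face here (the nested-tori faces are crew rows S43 (refinement) ∕ S44 (closure)).  WHAT IT SAYS FOR THE
WALL (the owner's reading, Q47 RULED T4-DAG v45 §8; nothing re-labelled here):
(B3-count) = the 𝐃-step (N0s), the Y₀∕P-step (N0u), the components-and-{Z′_i}-step (N0w ∘ N0v) and the Z∖Z′₀-step (N0v) as ONE kernel
implication BY NAME on the cell's two (2.11)-geometries; DISPLAYED of printed KIND remain ONLY the links ((2.27) off-diagonal ∕ (2.32) ∕
(2.37)), the (2.36) transfer and the anchor∕closure READING data.  NOTHING of (B3) discharged on Bałaban's (2.14) densities; 0 binders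
instantiated on Bałaban's densities; no wall item moves; wall v1.7 (T4-DAG v46) does NOT move; R-t4r2-Q2 NOT met thereby; NE1′ ⇐ the named
binders — NOT printed, NOT proved; spine PROVED 0∕9; count 9 unchanged.
HONEST FRAMING.  By-name composition over SHAPES; cores ∕ labels are the cell's typed FORMAT of (2.14), NOT Bałaban's functions; `G`∕`Gk`
HYPOTHESIS structures; printed loci ([Balaban1988RGII] pp. 17–20, (1.26) p. 8) TYPE ∕ CONTEXT via PART 1's ∕ the owner's headers; ABSOLUTE
RULE honoured ([folklore] kernel theorems only).  Rung (B)+1 on ONE finite four-torus — NOT infinite volume, NOT a mass gap, NOT OS on ℝ⁴, NOT Clay.  HONEST DEPENDENCY: continuum YM on T⁴ ⇐ BetaPertH ∧ nine spine estimates (0/9 proved); BetaPertH ⇐ (D1) ∧ (D4) ∧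
CAP+tail; G-an2-4 gates asym, D1 and NE2/3/4.
-/

noncomputable section

namespace Summit.QuantumFields.BalabanUV.T4Continuum.NE1p.DressedSmallFieldComponentInner

open Metric Set Complex MeasureTheory
open scoped BigOperators
open Literature.MathematicalPhysics.QuantumFieldTheory.Balaban1983to89 (LocDomainSys)
open Literature.MathematicalPhysics.QuantumFieldTheory.Balaban1983to89.B13FamilySum (coveringFamilies Ineq229
  ineq229_locDomainSys)
open Literature.MathematicalPhysics.QuantumFieldTheory.Balaban1983to89.T4OutputRate (Carriers)
open Literature.MathematicalPhysics.QuantumFieldTheory.Balaban1983to89.B13Resummation (locE Geometry)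
open Summit.QuantumFields.BalabanUV.T4Continuum.B13HistMeasurable (MeasPotFrame B13HistM)
open Summit.QuantumFields.BalabanUV.T4Continuum.B13TermParamGaussianBi (BiCore)
open Summit.QuantumFields.BalabanUV.T4Continuum.NE1p.DressedSmallFieldFamilyCount (c₁_pos_of_geometry)
open Summit.QuantumFields.BalabanUV.T4Continuum.NE1p.DressedSmallFieldInnerCount (innerCount_le_decay)
open Summit.QuantumFields.BalabanUV.T4Continuum.NE1p.DressedSmallFieldComponentCount
  (attachedPart_locE_le_of_coresAt_pencil_components)
open Summit.QuantumFields.BalabanUV.T4Continuum.NE1p.DressedSmallFieldComponentSets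
  (attachedPart_locE_le_of_coresAt_pencil_componentSets)

/-! ## §1 N0w's displayed inner-count SHAPE `hinner`, SUPPLIED for N0u's own labels by N0u's `innerCount_le_decay` -/

section Inner

variable {Dk : LocDomainSys} {CubeK : Type} [DecidableEq CubeK] {Bnd : Type} [DecidableEq Bnd] (Gk : Geometry Dk CubeK)

/-- **THE INNER COUNT OF ONE COMPONENT IN N0w's SHAPE** (kernel; N0u's `innerCount_le_decay` ONCE BY NAME at `C₀ := Gk.cubes Z₀`
with the volume bound `Gk.volBound Z₀`, (2.29) at scale `k` by b13's `ineq229_locDomainSys` on `Gk` (print's order of choice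
`κ₀ + 1 ≤ δκ`, `e K₀ c₁ α₆ ≤ 1`), the bonds-per-cube clause `hb₀` and the (2.27)∘(2.32)-KIND link `hlink` DISPLAYED): over N0u's
admissible inner labels `⟨W, (𝐃, P)⟩` of `Z₀` (WRITTEN OUT: `W ⊆ Gk.cubes Z₀`, `𝐃` covering `Gk.cubes Z₀ ∖ W` exactly, `P ⊆ bondsOf W`,
`#W ≤ 2·#P`) the table-blind majorants sum to `≤ e^{c₀}·e^{−R₀ d_k(Z₀)}` with `c₀ := Gk.c₁u_k − 5R_k`, `R₀ := R_k − Gk.c₁u_k`,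
`u_k := e^{R_k c₃₂}·s·e^{b₀t}` — EXACTLY N0w's `hinner` for `I :=` the admissible labels, `m :=` N0u's majorant. [folklore] -/
theorem innerSum_le_of_innerCount (bondsOf : Finset CubeK → Finset Bnd) {δ κ α₆ Rk c₃₂ b₀ s t : ℝ}
    (hα₆ : 0 ≤ α₆) (hκ : Gk.κ₀ + 1 ≤ δ * κ) (h229 : Real.exp 1 * Gk.K₀ * Gk.c₁ * α₆ ≤ 1)
    (hs0 : 0 ≤ s) (hs1 : s ≤ 1) (ht : 0 ≤ t) (hb₀ : ∀ W, ((bondsOf W).card : ℝ) ≤ b₀ * W.card) (hR : 0 ≤ Rk) (Z₀ : Dk.Dom)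
    (hlink : ∀ W ⊆ Gk.cubes Z₀, ∀ Df ∈ coveringFamilies Finset.univ Gk.cubes (Gk.cubes Z₀ \ W),
      Dk.dj Z₀ + 5 ≤ ∑ Y ∈ Df, (Dk.dj Y + 5) + c₃₂ * W.card) :
    ∑ l ∈ (Gk.cubes Z₀).powerset.sigma (fun W => coveringFamilies Finset.univ Gk.cubes (Gk.cubes Z₀ \ W) ×ˢ
        (bondsOf W).powerset.filter fun P => W.card ≤ 2 * P.card),
      (∏ Y ∈ l.2.1, (α₆ * Real.exp (-(δ * κ * Dk.dj Y)) * Real.exp (-(Rk * (Dk.dj Y + 5))))) * (s ^ 2 * t) ^ l.2.2.card ≤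
      Real.exp (Gk.c₁ * (Real.exp (Rk * c₃₂) * s * Real.exp (b₀ * t)) - 5 * Rk) *
        Real.exp (-((Rk - Gk.c₁ * (Real.exp (Rk * c₃₂) * s * Real.exp (b₀ * t))) * Dk.dj Z₀)) := by
  have hc₁ : 0 < Gk.c₁ := c₁_pos_of_geometry Gk Z₀
  have h229' : Ineq229 (Finset.univ : Finset Dk.Dom) Gk.cubes Dk.dj α₆ (δ * κ) :=
    ineq229_locDomainSys Dk Gk.cubes Gk.κ₀ Gk.K₀ Gk.c₁ δ κ α₆ 1 Gk.cubes_nonempty Gk.volBound Gk.ineq126 hα₆ zero_le_one hc₁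
      hκ (by linarith)
  exact innerCount_le_decay Finset.univ Gk.cubes Dk.dj bondsOf (Gk.cubes Z₀) (r := δ * κ) (dZ₀ := Dk.dj Z₀) hα₆ hR hs0 hs1 ht
    (Gk.volBound Z₀ (Finset.mem_univ _)) (fun W _ => hb₀ W) (fun Y₀ _ => h229' Y₀) hlink
    (fun l hl => by
      obtain ⟨hW, hq⟩ := Finset.mem_sigma.1 hl
      obtain ⟨hD, hP⟩ := Finset.mem_product.1 hq
      exact ⟨Finset.mem_powerset.1 hW, hD, Finset.mem_powerset.1 (Finset.mem_filter.1 hP).1, (Finset.mem_filter.1 hP).2⟩)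

end Inner

/-! ## §2 THE ENDs WITH N0u COMPOSED: N0w's (one component per member) and PART 1's (nonempty sets of components) -/

section End

variable {C : Carriers} {P : MeasPotFrame C} {Op : Type*} [NormedAddCommGroup Op] [NormedSpace ℂ Op] {Dk : LocDomainSys}
  {CubeK : Type} [DecidableEq CubeK] {Bnd : Type} [DecidableEq Bnd]
variable (D : LocDomainSys) {Cube : Type} [DecidableEq Cube] (G : Geometry D Cube) (Gk : Geometry Dk CubeK)

section Single

variable
  {𝒴 : ℕ → (Σ _ : Finset Cube, Σ F : Finset D.Dom, ∀ Z ∈ F,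
    (Σ _ : Dk.Dom, (Σ _ : Finset CubeK, Finset Dk.Dom × Finset Bnd))) → Type*} {dom : ∀ k i, 𝒴 k i → C.Dom}
  {β : ℕ → (Σ _ : Finset Cube, Σ F : Finset D.Dom, ∀ Z ∈ F,
    (Σ _ : Dk.Dom, (Σ _ : Finset CubeK, Finset Dk.Dom × Finset Bnd))) → Type*} [∀ k i, MeasurableSpace (β k i)]
  {α : ℕ → (Σ _ : Finset Cube, Σ F : Finset D.Dom, ∀ Z ∈ F,
    (Σ _ : Dk.Dom, (Σ _ : Finset CubeK, Finset Dk.Dom × Finset Bnd))) → Type*} [∀ k i, NormedAddCommGroup (α k i)]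
  [∀ k i, InnerProductSpace ℝ (α k i)] [∀ k i, FiniteDimensional ℝ (α k i)] [∀ k i, MeasurableSpace (α k i)]
  [∀ k i, BorelSpace (α k i)]

open Classical in
/-- **N0w's END WITH THE COMPONENTS' INNER COUNTS COMPOSED FROM N0u** (kernel; N0w's
`attachedPart_locE_le_of_coresAt_pencil_components` ONCE BY NAME at the inner-label type `Σ _ : Finset CubeK, Finset Dk.Dom × Finset Bnd`
— N0u's `⟨W, (𝐃, P)⟩` —, `I Z₀ :=` N0u's admissible labels WRITTEN OUT, `m :=` N0u's majorant, `c₀ := Gk.c₁u_k − 5R_k`,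
`R₀ := R_k − Gk.c₁u_k`, and `hinner` SUPPLIED by §1 `innerSum_le_of_innerCount` — so N0w's only SHAPE binder is GONE).  DISPLAYED of
printed KIND: N0u's (2.27)∘(2.32) link `hlinkk` per component, N0v's (2.27)∘(2.37) link `hlink`, N0w's anchor `hanchor`∕`hA` and
(2.36) transfer `htransfer`; the READING data `cl`∕`anc`∕`bondsOf`∕`hadm`; the (2.29) clauses at both scales; the rate bookkeeping
`hκR : Gk.κ₀ ≤ R_k − Gk.c₁u_k`, `hrate2 : r + R ≤ (R_k − Gk.c₁u_k − Gk.κ₀)·ℓ`, `h229` at N0w's amplitude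
`ε·e^{Gk.c₁u_k − 5R_k}·Aₐ·Gk.K₀·e^{5R}`.  Every other binder VERBATIM N0w's = N0v's = N0s's; conclusion N0s's. [folklore] -/
theorem attachedPart_locE_le_of_coresAt_pencil_components_inner {Win : Set (ℕ → ℝ)}
    {ctr : ℕ → (ℕ → ℝ) → C.BgB → Op × B13HistM P} {ROp RHist R' : ℕ → ℝ}
    (𝔊 : ∀ k i, C.Dom → BiCore P (dom k i) Op (β k i) (α k i))
    {mq bq N₀ : ℕ → (Σ _ : Finset Cube, Σ F : Finset D.Dom, ∀ Z ∈ F,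
      (Σ _ : Dk.Dom, (Σ _ : Finset CubeK, Finset Dk.Dom × Finset Bnd))) → C.Dom → ℝ}
    (hroom : ∀ k, ROp k < R' k)
    (hm : ∀ k, ∀ g ∈ Win, ∀ (U : C.BgB) (X : C.Dom), C.scale X = k → ∀ i, 0 < mq k i X)
    (hN : ∀ k, ∀ g ∈ Win, ∀ (U : C.BgB) (X : C.Dom), C.scale X = k → ∀ i,
      (∀ o ∈ ball (ctr k g U).1 (R' k), AEStronglyMeasurable ((𝔊 k i X).N o) (𝔊 k i X).lam) ∧
      (∀ p, DifferentiableOn ℂ (fun o => (𝔊 k i X).N o p) (ball (ctr k g U).1 (R' k))) ∧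
      (∀ o ∈ ball (ctr k g U).1 (R' k), ∀ p, ‖(𝔊 k i X).N o p‖ ≤ N₀ k i X))
    (hq : ∀ k, ∀ g ∈ Win, ∀ (U : C.BgB) (X : C.Dom), C.scale X = k → ∀ i,
      (∀ o ∈ ball (ctr k g U).1 (R' k),
        AEStronglyMeasurable (Function.uncurry ((𝔊 k i X).q o)) ((𝔊 k i X).lam.prod volume)) ∧
      (∀ p v, DifferentiableOn ℂ (fun o => (𝔊 k i X).q o p v) (ball (ctr k g U).1 (R' k))) ∧
      (∀ o ∈ ball (ctr k g U).1 (R' k), ∀ p v, mq k i X * ‖v‖ ^ 2 - bq k i X ≤ ((𝔊 k i X).q o p v).re))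
    {k : ℕ} {g : ℕ → ℝ} (hg : g ∈ Win) {U : C.BgB} {o : Op} {h₀ w : B13HistM P} {ϱ : ℝ}
    (hO : ‖o - (ctr k g U).1‖ ≤ ROp k) (hH : ‖h₀ - (ctr k g U).2‖ + ϱ * ‖w‖ ≤ RHist k)
    {emb : D.Dom → C.Dom} (hscale : ∀ Z, C.scale (emb Z) = k)
    {terms : D.Dom → Finset (Σ _ : Finset Cube, Σ F : Finset D.Dom, ∀ Z ∈ F,
      (Σ _ : Dk.Dom, (Σ _ : Finset CubeK, Finset Dk.Dom × Finset Bnd)))} {act : ℂ → D.Dom → ℂ}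
    (hact : ∀ σ ∈ ball (0 : ℂ) ϱ, ∀ Z, act σ Z = ∑ i ∈ terms Z, (𝔊 k i (emb Z)).termAt o (h₀ + σ • w))
    {A₀ A₁ Rkp r₁ b₅ : ℝ} {X₀ : D.Dom} (hA₀ : 0 ≤ A₀) (hA₁ : 0 ≤ A₁) (hr₁ : 0 ≤ r₁) (hb : r₁ * 5 ≤ b₅)
    (hrate : r₁ + 2 * G.κ₀ + 2 ≤ Rkp) (hsmall : (A₀ + ϱ * A₁) * Real.exp (b₅ + 1) * G.K₀ * G.ν * G.c₁ ≤ 1)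
    -- scale `k`: N0u's letters and clauses (per component)
    (bondsOf : Finset CubeK → Finset Bnd) {δ κ α₆ Rk c₃₂ b₀ s t : ℝ}
    (hα₆ : 0 ≤ α₆) (hκk : Gk.κ₀ + 1 ≤ δ * κ) (h229k : Real.exp 1 * Gk.K₀ * Gk.c₁ * α₆ ≤ 1)
    (hs0 : 0 ≤ s) (hs1 : s ≤ 1) (ht : 0 ≤ t) (hb₀ : ∀ W, ((bondsOf W).card : ℝ) ≤ b₀ * W.card)
    (hlinkk : ∀ Z₀ : Dk.Dom, ∀ W ⊆ Gk.cubes Z₀, ∀ Df ∈ coveringFamilies Finset.univ Gk.cubes (Gk.cubes Z₀ \ W),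
      Dk.dj Z₀ + 5 ≤ ∑ Y ∈ Df, (Dk.dj Y + 5) + c₃₂ * W.card)
    -- N0w's anchored closure and N0v's letters
    (cl : Dk.Dom → D.Dom) (anc : D.Dom → Finset CubeK) {ε Aₐ ℓ r R c' v : ℝ} (hε : 0 ≤ ε) (hv : 0 ≤ v)
    (hanchor : ∀ Z₀ Z', cl Z₀ = Z' → ∃ c ∈ anc Z', c ∈ Gk.cubes Z₀) (hA : ∀ Z', ((anc Z').card : ℝ) ≤ Aₐ)
    (htransfer : ∀ Z₀ Z', cl Z₀ = Z' → ℓ * D.dj Z' ≤ Dk.dj Z₀)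
    (hκR : Gk.κ₀ ≤ Rk - Gk.c₁ * (Real.exp (Rk * c₃₂) * s * Real.exp (b₀ * t)))
    (hrate2 : r + R ≤ (Rk - Gk.c₁ * (Real.exp (Rk * c₃₂) * s * Real.exp (b₀ * t)) - Gk.κ₀) * ℓ)
    (hκ : G.κ₀ + 1 ≤ r)
    (h229 : Real.exp 1 * G.K₀ * G.c₁ *
      (ε * Real.exp (Gk.c₁ * (Real.exp (Rk * c₃₂) * s * Real.exp (b₀ * t)) - 5 * Rk) * Aₐ * Gk.K₀ * Real.exp (5 * R)) ≤ 1)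
    (hlink : ∀ Z, ∀ W ⊆ G.cubes Z, ∀ F ∈ coveringFamilies Finset.univ G.cubes (G.cubes Z \ W),
      D.dj Z - c' * W.card + 5 ≤ ∑ Z' ∈ F, (D.dj Z' + 5))
    (hRR : Rkp ≤ R - G.c₁ * (v * Real.exp (R * c')))
    (hadm : ∀ Z, ∀ l ∈ terms Z, l.1 ⊆ G.cubes Z ∧
      l.2.1 ∈ coveringFamilies Finset.univ G.cubes (G.cubes Z \ l.1) ∧
      ∀ Z' (h : Z' ∈ l.2.1), l.2.2 Z' h ∈ ((Finset.univ : Finset Dk.Dom).filter (fun Z₀ => cl Z₀ = Z')).sigma fun Z₀ =>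
        (Gk.cubes Z₀).powerset.sigma fun W => coveringFamilies Finset.univ Gk.cubes (Gk.cubes Z₀ \ W) ×ˢ
          (bondsOf W).powerset.filter fun P => W.card ≤ 2 * P.card)
    (hAmp : ∀ Z, G.cubes Z ⊆ G.cubes X₀ → ∀ l ∈ terms Z,
      (𝔊 k l (emb Z)).lam.real univ * ((𝔊 k l (emb Z)).wB * N₀ k l (emb Z) * Real.exp (bq k l (emb Z))) *
          (Real.pi / (mq k l (emb Z) / 2)) ^ (Module.finrank ℝ (α k l) / 2 : ℝ) *
        Real.exp ((𝔊 k l (emb Z)).N₁ * (‖h₀‖ + ϱ * ‖w‖)) ≤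
      (A₀ + ϱ * A₁) * (v ^ l.1.card * ∏ x ∈ l.2.1.attach, (ε *
        ((∏ Y ∈ (l.2.2 x.1 x.2).2.2.1, (α₆ * Real.exp (-(δ * κ * Dk.dj Y)) * Real.exp (-(Rk * (Dk.dj Y + 5))))) *
          (s ^ 2 * t) ^ (l.2.2 x.1 x.2).2.2.2.card))))
    (hϱ : 2 ≤ ϱ) (hϱA : A₀ ≤ ϱ * A₁) :
    ‖locE G.ι G.cubes (act 1) (G.cubes X₀) - locE G.ι G.cubes (act 0) (G.cubes X₀)‖ ≤
      4 * (Real.exp 1 * G.ν * G.c₁ * G.K₀ ^ 2) * A₁ * Real.exp (-(r₁ * D.dj X₀)) :=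
  have hcu : 0 ≤ Gk.c₁ * (Real.exp (Rk * c₃₂) * s * Real.exp (b₀ * t)) := mul_nonneg Gk.c₁_nonneg (by positivity)
  have hR : 0 ≤ Rk := by linarith [Gk.κ₀_nonneg]
  attachedPart_locE_le_of_coresAt_pencil_components D G Gk 𝔊 hroom hm hN hq hg hO hH hscale hact hA₀ hA₁ hr₁ hb hrate hsmall
    (fun Z₀ => (Gk.cubes Z₀).powerset.sigma fun W => coveringFamilies Finset.univ Gk.cubes (Gk.cubes Z₀ \ W) ×ˢ
      (bondsOf W).powerset.filter fun P => W.card ≤ 2 * P.card)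
    (fun _ l => (∏ Y ∈ l.2.1, (α₆ * Real.exp (-(δ * κ * Dk.dj Y)) * Real.exp (-(Rk * (Dk.dj Y + 5))))) *
      (s ^ 2 * t) ^ l.2.2.card)
    (fun _ l => mul_nonneg (Finset.prod_nonneg fun Y _ => by positivity) (by positivity)) cl anc hε hv
    (fun Z₀ => innerSum_le_of_innerCount Gk bondsOf hα₆ hκk h229k hs0 hs1 ht hb₀ hR Z₀ (hlinkk Z₀))
    hanchor hA htransfer hκR hrate2 hκ h229 hlink hRR hadm hAmp hϱ hϱA

end Single

section Sets

variable
  {𝒴 : ℕ → (Σ _ : Finset Cube, Σ F : Finset D.Dom, ∀ Z ∈ F,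
    Finset (Σ _ : Dk.Dom, (Σ _ : Finset CubeK, Finset Dk.Dom × Finset Bnd))) → Type*} {dom : ∀ k i, 𝒴 k i → C.Dom}
  {β : ℕ → (Σ _ : Finset Cube, Σ F : Finset D.Dom, ∀ Z ∈ F,
    Finset (Σ _ : Dk.Dom, (Σ _ : Finset CubeK, Finset Dk.Dom × Finset Bnd))) → Type*} [∀ k i, MeasurableSpace (β k i)]
  {α : ℕ → (Σ _ : Finset Cube, Σ F : Finset D.Dom, ∀ Z ∈ F,
    Finset (Σ _ : Dk.Dom, (Σ _ : Finset CubeK, Finset Dk.Dom × Finset Bnd))) → Type*} [∀ k i, NormedAddCommGroup (α k i)]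
  [∀ k i, InnerProductSpace ℝ (α k i)] [∀ k i, FiniteDimensional ℝ (α k i)] [∀ k i, MeasurableSpace (α k i)]
  [∀ k i, BorelSpace (α k i)]

open Classical in
/-- **PART 1's SET-VALUED END WITH THE COMPONENTS' INNER COUNTS COMPOSED FROM N0u** (kernel; PART 1's
`attachedPart_locE_le_of_coresAt_pencil_componentSets` ONCE BY NAME — for every member `Z′_i` a NONEMPTY SET of anchored scale-`k`
components each carrying one of N0u's labels `⟨W, (𝐃, P)⟩` (print p. 19: n ≥ 1 components determining `Z′_i`) —, with `I`∕`m`∕`c₀`∕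
`R₀` as in `attachedPart_locE_le_of_coresAt_pencil_components_inner` and `hinner` SUPPLIED by §1).  DISPLAYED as there, with `hadm`'s
NONEMPTY-SUBSET clause, `hAmp`'s set-product majorant and `h229` at PART 1's amplitude `A·e^{5R}·e^{A}`,
`A := ε·e^{Gk.c₁u_k − 5R_k}·Aₐ·Gk.K₀`.  Conclusion N0s's. [folklore] -/
theorem attachedPart_locE_le_of_coresAt_pencil_componentSets_inner {Win : Set (ℕ → ℝ)}
    {ctr : ℕ → (ℕ → ℝ) → C.BgB → Op × B13HistM P} {ROp RHist R' : ℕ → ℝ}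
    (𝔊 : ∀ k i, C.Dom → BiCore P (dom k i) Op (β k i) (α k i))
    {mq bq N₀ : ℕ → (Σ _ : Finset Cube, Σ F : Finset D.Dom, ∀ Z ∈ F,
      Finset (Σ _ : Dk.Dom, (Σ _ : Finset CubeK, Finset Dk.Dom × Finset Bnd))) → C.Dom → ℝ}
    (hroom : ∀ k, ROp k < R' k)
    (hm : ∀ k, ∀ g ∈ Win, ∀ (U : C.BgB) (X : C.Dom), C.scale X = k → ∀ i, 0 < mq k i X)
    (hN : ∀ k, ∀ g ∈ Win, ∀ (U : C.BgB) (X : C.Dom), C.scale X = k → ∀ i,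
      (∀ o ∈ ball (ctr k g U).1 (R' k), AEStronglyMeasurable ((𝔊 k i X).N o) (𝔊 k i X).lam) ∧
      (∀ p, DifferentiableOn ℂ (fun o => (𝔊 k i X).N o p) (ball (ctr k g U).1 (R' k))) ∧
      (∀ o ∈ ball (ctr k g U).1 (R' k), ∀ p, ‖(𝔊 k i X).N o p‖ ≤ N₀ k i X))
    (hq : ∀ k, ∀ g ∈ Win, ∀ (U : C.BgB) (X : C.Dom), C.scale X = k → ∀ i,
      (∀ o ∈ ball (ctr k g U).1 (R' k),
        AEStronglyMeasurable (Function.uncurry ((𝔊 k i X).q o)) ((𝔊 k i X).lam.prod volume)) ∧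
      (∀ p v, DifferentiableOn ℂ (fun o => (𝔊 k i X).q o p v) (ball (ctr k g U).1 (R' k))) ∧
      (∀ o ∈ ball (ctr k g U).1 (R' k), ∀ p v, mq k i X * ‖v‖ ^ 2 - bq k i X ≤ ((𝔊 k i X).q o p v).re))
    {k : ℕ} {g : ℕ → ℝ} (hg : g ∈ Win) {U : C.BgB} {o : Op} {h₀ w : B13HistM P} {ϱ : ℝ}
    (hO : ‖o - (ctr k g U).1‖ ≤ ROp k) (hH : ‖h₀ - (ctr k g U).2‖ + ϱ * ‖w‖ ≤ RHist k)
    {emb : D.Dom → C.Dom} (hscale : ∀ Z, C.scale (emb Z) = k)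
    {terms : D.Dom → Finset (Σ _ : Finset Cube, Σ F : Finset D.Dom, ∀ Z ∈ F,
      Finset (Σ _ : Dk.Dom, (Σ _ : Finset CubeK, Finset Dk.Dom × Finset Bnd)))} {act : ℂ → D.Dom → ℂ}
    (hact : ∀ σ ∈ ball (0 : ℂ) ϱ, ∀ Z, act σ Z = ∑ i ∈ terms Z, (𝔊 k i (emb Z)).termAt o (h₀ + σ • w))
    {A₀ A₁ Rkp r₁ b₅ : ℝ} {X₀ : D.Dom} (hA₀ : 0 ≤ A₀) (hA₁ : 0 ≤ A₁) (hr₁ : 0 ≤ r₁) (hb : r₁ * 5 ≤ b₅)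
    (hrate : r₁ + 2 * G.κ₀ + 2 ≤ Rkp) (hsmall : (A₀ + ϱ * A₁) * Real.exp (b₅ + 1) * G.K₀ * G.ν * G.c₁ ≤ 1)
    -- scale `k`: N0u's letters and clauses (per component)
    (bondsOf : Finset CubeK → Finset Bnd) {δ κ α₆ Rk c₃₂ b₀ s t : ℝ}
    (hα₆ : 0 ≤ α₆) (hκk : Gk.κ₀ + 1 ≤ δ * κ) (h229k : Real.exp 1 * Gk.K₀ * Gk.c₁ * α₆ ≤ 1)
    (hs0 : 0 ≤ s) (hs1 : s ≤ 1) (ht : 0 ≤ t) (hb₀ : ∀ W, ((bondsOf W).card : ℝ) ≤ b₀ * W.card)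
    (hlinkk : ∀ Z₀ : Dk.Dom, ∀ W ⊆ Gk.cubes Z₀, ∀ Df ∈ coveringFamilies Finset.univ Gk.cubes (Gk.cubes Z₀ \ W),
      Dk.dj Z₀ + 5 ≤ ∑ Y ∈ Df, (Dk.dj Y + 5) + c₃₂ * W.card)
    -- N0w's anchored closure and N0v's letters
    (cl : Dk.Dom → D.Dom) (anc : D.Dom → Finset CubeK) {ε Aₐ ℓ r R c' v : ℝ} (hε : 0 ≤ ε) (hv : 0 ≤ v)
    (hanchor : ∀ Z₀ Z', cl Z₀ = Z' → ∃ c ∈ anc Z', c ∈ Gk.cubes Z₀) (hA : ∀ Z', ((anc Z').card : ℝ) ≤ Aₐ)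
    (htransfer : ∀ Z₀ Z', cl Z₀ = Z' → ℓ * D.dj Z' ≤ Dk.dj Z₀)
    (hκR : Gk.κ₀ ≤ Rk - Gk.c₁ * (Real.exp (Rk * c₃₂) * s * Real.exp (b₀ * t)))
    (hrate2 : r + R ≤ (Rk - Gk.c₁ * (Real.exp (Rk * c₃₂) * s * Real.exp (b₀ * t)) - Gk.κ₀) * ℓ)
    (hκ : G.κ₀ + 1 ≤ r)
    (h229 : Real.exp 1 * G.K₀ * G.c₁ *
      (ε * Real.exp (Gk.c₁ * (Real.exp (Rk * c₃₂) * s * Real.exp (b₀ * t)) - 5 * Rk) * Aₐ * Gk.K₀ * Real.exp (5 * R) *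
        Real.exp (ε * Real.exp (Gk.c₁ * (Real.exp (Rk * c₃₂) * s * Real.exp (b₀ * t)) - 5 * Rk) * Aₐ * Gk.K₀)) ≤ 1)
    (hlink : ∀ Z, ∀ W ⊆ G.cubes Z, ∀ F ∈ coveringFamilies Finset.univ G.cubes (G.cubes Z \ W),
      D.dj Z - c' * W.card + 5 ≤ ∑ Z' ∈ F, (D.dj Z' + 5))
    (hRR : Rkp ≤ R - G.c₁ * (v * Real.exp (R * c')))
    (hadm : ∀ Z, ∀ l ∈ terms Z, l.1 ⊆ G.cubes Z ∧
      l.2.1 ∈ coveringFamilies Finset.univ G.cubes (G.cubes Z \ l.1) ∧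
      ∀ Z' (h : Z' ∈ l.2.1), (l.2.2 Z' h).Nonempty ∧
        l.2.2 Z' h ⊆ ((Finset.univ : Finset Dk.Dom).filter (fun Z₀ => cl Z₀ = Z')).sigma fun Z₀ =>
          (Gk.cubes Z₀).powerset.sigma fun W => coveringFamilies Finset.univ Gk.cubes (Gk.cubes Z₀ \ W) ×ˢ
            (bondsOf W).powerset.filter fun P => W.card ≤ 2 * P.card)
    (hAmp : ∀ Z, G.cubes Z ⊆ G.cubes X₀ → ∀ l ∈ terms Z,
      (𝔊 k l (emb Z)).lam.real univ * ((𝔊 k l (emb Z)).wB * N₀ k l (emb Z) * Real.exp (bq k l (emb Z))) *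
          (Real.pi / (mq k l (emb Z) / 2)) ^ (Module.finrank ℝ (α k l) / 2 : ℝ) *
        Real.exp ((𝔊 k l (emb Z)).N₁ * (‖h₀‖ + ϱ * ‖w‖)) ≤
      (A₀ + ϱ * A₁) * (v ^ l.1.card * ∏ x ∈ l.2.1.attach, ∏ j ∈ l.2.2 x.1 x.2, (ε *
        ((∏ Y ∈ j.2.2.1, (α₆ * Real.exp (-(δ * κ * Dk.dj Y)) * Real.exp (-(Rk * (Dk.dj Y + 5))))) *
          (s ^ 2 * t) ^ j.2.2.2.card))))
    (hϱ : 2 ≤ ϱ) (hϱA : A₀ ≤ ϱ * A₁) :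
    ‖locE G.ι G.cubes (act 1) (G.cubes X₀) - locE G.ι G.cubes (act 0) (G.cubes X₀)‖ ≤
      4 * (Real.exp 1 * G.ν * G.c₁ * G.K₀ ^ 2) * A₁ * Real.exp (-(r₁ * D.dj X₀)) :=
  have hcu : 0 ≤ Gk.c₁ * (Real.exp (Rk * c₃₂) * s * Real.exp (b₀ * t)) := mul_nonneg Gk.c₁_nonneg (by positivity)
  have hR : 0 ≤ Rk := by linarith [Gk.κ₀_nonneg]
  attachedPart_locE_le_of_coresAt_pencil_componentSets D G Gk 𝔊 hroom hm hN hq hg hO hH hscale hact hA₀ hA₁ hr₁ hb hrate hsmall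
    (fun Z₀ => (Gk.cubes Z₀).powerset.sigma fun W => coveringFamilies Finset.univ Gk.cubes (Gk.cubes Z₀ \ W) ×ˢ
      (bondsOf W).powerset.filter fun P => W.card ≤ 2 * P.card)
    (fun _ l => (∏ Y ∈ l.2.1, (α₆ * Real.exp (-(δ * κ * Dk.dj Y)) * Real.exp (-(Rk * (Dk.dj Y + 5))))) *
      (s ^ 2 * t) ^ l.2.2.card)
    (fun _ l => mul_nonneg (Finset.prod_nonneg fun Y _ => by positivity) (by positivity)) cl anc hε hv
    (fun Z₀ => innerSum_le_of_innerCount Gk bondsOf hα₆ hκk h229k hs0 hs1 ht hb₀ hR Z₀ (hlinkk Z₀))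
    hanchor hA htransfer hκR hrate2 hκ h229 hlink hRR hadm hAmp hϱ hϱA

end Sets

end End

end Summit.QuantumFields.BalabanUV.T4Continuum.NE1p.DressedSmallFieldComponentInner

end
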